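import Mathlib
import Summits.ValiantsHypothesis.ValiantsHypothesis.Theorems.BarrierLeverPartitionMinorsHitByVPHiddenStatesSplitRule

/-!
# Route BarrierLever — item `PartitionMinorsHitByVP` (stmt-ValiantsHypothesis-19717):
# the TRIPLE-ROW RANK BOUND — rows of size ≤ 3 against a two-layer hidden family span few dimensions

Helper file (`--supports stmt-ValiantsHypothesis-19717`; cell valiant-natproofs, rung V4, 𝒟-side door (c), line
`hidden-states`; prover seat val-np-p3 gen 9). Definition-free; route-independent (imports the split-rule engine only for
the namespace conventions). Closes NO item; it is the engine of the 2-SKELETON OBSTRUCTION of the seat memo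
(HOME/val-np-p3/g9/MEMO-qstar-structure-valnp3-g9.md §10).

THE BOUND. Let `e : n → Finset (Fin K)` be a hidden family whose members have at most two states, with every two-state
member inside a fixed set `S` of states (a TWO-LAYER family with its pairs on `|S|` states — e.g. every ball–colex family
`𝔅(K, r)` with `K + 1 < r ≤ 1 + K + K(K−1)/2`, whose pairs are a binary-initial segment on `K'` states). For EVERY table
`tx`, every row `i` of the additive matrix `[∏_{a ∈ u i}(tx none a + Σ_{q ∈ e k} tx (some q) a)]_{i,k}` with `|u i| ≤ 3` is a
linear combination of the `1 + K + |S|·h` FIXED column-functions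
`k ↦ 1`, `k ↦ [q ∈ e k]` (`q < K`), `k ↦ [p ∈ e k] · Σ_{p' ∈ e k ∖ p} tx (some p') a` (`p ∈ S`, `a < h`)
(`row_mem_span`). Consequently (`det_eq_zero_of_many_small_rows`): if more than `1 + K + |S|·h` rows have `|u i| ≤ 3`, the
additive matrix is SINGULAR FOR EVERY TABLE — so `SymbGood u e` fails and no hidden-state certificate through `e` exists.

USE (memo §10): with `u` = an enumeration of `B₃([h])` (all sets of size `≤ 3`, `r = |B₃(h)|`) and `e` = the ball–colex family
`𝔅(K, r)` in its two-layer regime (pairs on `K'(c)` states, `c = r − 1 − K`), the count `|B₃(h)| > 1 + K + h·K'(c)` holds for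
`K = h·h` and all `h ≥ 20` — the single-cube Conjecture Q\*(h²) is false; the exact window of failure observed in the census
(h = 8, 9, 10: K ∈ [13,15], [14,38], [16,59]) is this bound sharpened by `− C(h,2)`. The door of record (`K = h³`) is not
touched (`|B₃(h)| < h³`).

* `TripleRank.lin`, `TripleRank.pairFun`, `TripleRank.indFun` (abbreviations), `TripleRank.ColIdx`, `TripleRank.colVec`
  — the column-functions and their index type `Option (Fin K) ⊕ (S × Fin h)`; `TripleRank.gam`, `TripleRank.coef` — the
  explicit coefficients of a small row (plain bookkeeping `def`s, no mathematical content).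
* `TripleRank.prod_lin_pair` — the second-difference identity for `|U| ≤ 3` (case by case, `ring`).
* `TripleRank.row_eq_sum_coef`, `TripleRank.row_mem_span` — every row with `|u i| ≤ 3` is the fixed combination of the
  column-functions, hence lies in their span.
* `TripleRank.det_eq_zero_of_many_small_rows` — THE BOUND in singular form (dimension count:
  `LinearIndependent.fintype_card_le_finrank`, `finrank_range_le_card`, `Matrix.linearIndependent_rows_of_isUnit`).
* `TripleRank.not_symbGood_of_many_small_rows` — the same in the `SymbGood` language.

WHAT THIS IS NOT: not yet the parametric negative `¬ ∃ h₁, ∀ h ≥ h₁, ∀ r u, BallGood h (h·h) r u` (that needs the two-layer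
range lemma for ball–colex families and the arithmetic, memo §10 blueprint); nothing on joins (`stub_qjoinSharp` is not
touched by this mechanism), on the door of record `K = h³`, on crux 14610 or VP ≠ VNP.
-/

set_option linter.dupNamespace false

namespace Summit.ValiantsHypothesis.ValiantsHypothesis.Theorems.BarrierLever.HiddenStates

open Finset Matrix

noncomputable section

namespace TripleRank

variable {K h : ℕ} {n : Type*}

/-- The affine functional of coordinate `a` at the hidden set `J` for the table `tx`. -/
abbrev lin (tx : Option (Fin K) → Fin h → ℂ) (a : Fin h) (J : Finset (Fin K)) : ℂ :=
  tx none a + ∑ q ∈ J, tx (some q) a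

/-- The pair column-function of state `p` and coordinate `a`: `[p ∈ J] · Σ_{p' ∈ J ∖ p} tx (some p') a`. -/
abbrev pairFun (tx : Option (Fin K) → Fin h → ℂ) (p : Fin K) (a : Fin h) (J : Finset (Fin K)) : ℂ :=
  if p ∈ J then ∑ p' ∈ J.erase p, tx (some p') a else 0

/-- The indicator column-function of state `q`: `[q ∈ J]`. -/
abbrev indFun (q : Fin K) (J : Finset (Fin K)) : ℂ := if q ∈ J then 1 else 0

section identities

variable (tx : Option (Fin K) → Fin h → ℂ)

/-- `lin` at the empty hidden set. -/
theorem lin_empty (a : Fin h) : lin tx a ∅ = tx none a := by simp [lin]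

/-- `lin` at a singleton. -/
theorem lin_singleton (a : Fin h) (p : Fin K) : lin tx a {p} = tx none a + tx (some p) a := by simp [lin]

/-- `lin` at a pair. -/
theorem lin_pair (a : Fin h) {p p' : Fin K} (hpp : p ≠ p') :
    lin tx a {p, p'} = tx none a + tx (some p) a + tx (some p') a := by
  simp [lin, Finset.sum_pair hpp, add_assoc]

/-- `pairFun` vanishes at hidden sets of size `≤ 1`. -/
theorem pairFun_of_card_le_one (p : Fin K) (a : Fin h) (J : Finset (Fin K)) (hJ : J.card ≤ 1) :
    pairFun tx p a J = 0 := by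
  unfold pairFun
  split_ifs with hp
  · have : J.erase p = ∅ := by
      apply Finset.card_eq_zero.mp
      have := Finset.card_erase_of_mem hp
      omega
    rw [this, Finset.sum_empty]
  · rfl

/-- `pairFun` at a pair, first state. -/
theorem pairFun_pair_left (a : Fin h) {p p' : Fin K} (hpp : p ≠ p') :
    pairFun tx p a {p, p'} = tx (some p') a := by
  unfold pairFun
  rw [if_pos (Finset.mem_insert_self p _), Finset.erase_insert (by simpa using hpp), Finset.sum_singleton]

/-- `pairFun` at a pair, second state. -/
theorem pairFun_pair_right (a : Fin h) {p p' : Fin K} (hpp : p ≠ p') :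
    pairFun tx p' a {p, p'} = tx (some p) a := by
  rw [Finset.pair_comm]
  exact pairFun_pair_left tx a hpp.symm

/-- `pairFun` at a pair, a third state. -/
theorem pairFun_pair_other (a : Fin h) {p p' q : Fin K} (hq : q ≠ p) (hq' : q ≠ p') :
    pairFun tx q a {p, p'} = 0 := by
  unfold pairFun
  rw [if_neg]
  simp [hq, hq']

end identities

/-! ## The span statement -/

/-- The index type of the column-functions: `none` (constant), `some q` (indicator of state `q`), and `(p, a)` with `p ∈ S`
(pair function). -/
abbrev ColIdx (K h : ℕ) (S : Finset (Fin K)) := Option (Fin K) ⊕ (S × Fin h)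

/-- The column-functions as vectors indexed by the columns `k : n`. -/
def colVec (e : n → Finset (Fin K)) (S : Finset (Fin K)) (tx : Option (Fin K) → Fin h → ℂ) :
    ColIdx K h S → (n → ℂ)
  | Sum.inl none => fun _ => 1
  | Sum.inl (some q) => fun k => indFun q (e k)
  | Sum.inr (p, a) => fun k => pairFun tx p a (e k)

/-! ## The coefficient of a small row -/

section coefficients

variable (tx : Option (Fin K) → Fin h → ℂ)

/-- The pair coefficient `Γ_U(v)_a` for a row `U` with `|U| ≤ 3`, a state vector `v = tx (some p)` and a coordinate `a`:
`[|U∖a| = 2]·∏_{b∈U∖a} v_b + ½ Σ_{b∈U∖a} v_b ∏_{b'∈U∖a∖b} c_{b'}` if `a ∈ U`, else `0` (`c = tx none`). -/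
def gam (U : Finset (Fin h)) (p : Fin K) (a : Fin h) : ℂ :=
  if a ∈ U then
    (if (U.erase a).card = 2 then ∏ b ∈ U.erase a, tx (some p) b else 0) +
      (1 / 2) * ∑ b ∈ U.erase a, tx (some p) b * ∏ b' ∈ (U.erase a).erase b, tx none b'
  else 0

/-- The coefficient vector of the row `U` on the column-functions. -/
def coef (S : Finset (Fin K)) (U : Finset (Fin h)) : ColIdx K h S → ℂ
  | Sum.inl none => ∏ a ∈ U, tx none a
  | Sum.inl (some q) => (∏ a ∈ U, (tx none a + tx (some q) a)) - ∏ a ∈ U, tx none a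
  | Sum.inr (p, a) => gam tx U p a

/-- **The second-difference identity for rows of size ≤ 3** (the heart of the bound): for `|U| ≤ 3` and `p ≠ p'`,
`∏_{a∈U}(c_a + x_a + y_a) = ∏ c + (∏(c+x) − ∏ c) + (∏(c+y) − ∏ c) + Σ_{a∈U} (Γ_a(x)·y_a + Γ_a(y)·x_a)` with `x = tx (some p)`,
`y = tx (some p')`, `c = tx none`. Checked case by case on `|U| ∈ {0,1,2,3}` by `ring`. -/
theorem prod_lin_pair (U : Finset (Fin h)) (hU : U.card ≤ 3) {p p' : Fin K} (hpp : p ≠ p') :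
    ∏ a ∈ U, lin tx a {p, p'} =
      (∏ a ∈ U, tx none a) + ((∏ a ∈ U, (tx none a + tx (some p) a)) - ∏ a ∈ U, tx none a) +
        ((∏ a ∈ U, (tx none a + tx (some p') a)) - ∏ a ∈ U, tx none a) +
        ∑ a ∈ U, (gam tx U p a * tx (some p') a + gam tx U p' a * tx (some p) a) := by
  simp_rw [lin_pair tx _ hpp]
  -- case analysis on |U|
  rcases Nat.lt_or_ge U.card 1 with h0 | h1
  · have hUe : U = ∅ := Finset.card_eq_zero.mp (by omega)
    subst hUe
    simp
  rcases Nat.lt_or_ge U.card 2 with h1' | h2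
  · have hU1 : U.card = 1 := by omega
    obtain ⟨a, rfl⟩ := Finset.card_eq_one.mp hU1
    simp [gam]
  rcases Nat.lt_or_ge U.card 3 with h2' | h3
  · have hU2 : U.card = 2 := by omega
    obtain ⟨a, b, hab, rfl⟩ := Finset.card_eq_two.mp hU2
    have hba : b ≠ a := fun h' => hab h'.symm
    simp only [Finset.prod_pair hab, Finset.sum_pair hab, gam, Finset.mem_insert, Finset.mem_singleton,
      true_or, or_true, if_true, Finset.erase_insert (show a ∉ ({b} : Finset (Fin h)) by simpa using hab),
      Finset.card_singleton, Finset.prod_singleton, Finset.sum_singleton, Finset.erase_singleton,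
      Finset.prod_empty]
    rw [show ({a, b} : Finset (Fin h)).erase b = {a} by
      rw [Finset.erase_insert_of_ne hab, Finset.erase_singleton]; simp]
    simp only [Finset.card_singleton, Finset.prod_singleton, Finset.sum_singleton, Finset.erase_singleton,
      Finset.prod_empty]
    norm_num
    ring
  · have hU3 : U.card = 3 := by omega
    obtain ⟨a, b, d, hab, had, hbd, rfl⟩ := Finset.card_eq_three.mp hU3
    have hba : b ≠ a := fun h' => hab h'.symm
    have hda : d ≠ a := fun h' => had h'.symm
    have hdb : d ≠ b := fun h' => hbd h'.symm
    have hnot_a : a ∉ ({b, d} : Finset (Fin h)) := by simp [hab, had]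
    have hnot_b : b ∉ ({d} : Finset (Fin h)) := by simp [hbd]
    -- erase computations
    have eA : ({a, b, d} : Finset (Fin h)).erase a = {b, d} := Finset.erase_insert hnot_a
    have eB : ({a, b, d} : Finset (Fin h)).erase b = {a, d} := by
      rw [Finset.erase_insert_of_ne hab, Finset.erase_insert hnot_b]
    have eD : ({a, b, d} : Finset (Fin h)).erase d = {a, b} := by
      rw [Finset.erase_insert_of_ne had, Finset.erase_insert_of_ne hbd, Finset.erase_singleton]
      rfl
    have eBD_b : ({b, d} : Finset (Fin h)).erase b = {d} := Finset.erase_insert hnot_b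
    have eBD_d : ({b, d} : Finset (Fin h)).erase d = {b} := by
      rw [Finset.erase_insert_of_ne hbd, Finset.erase_singleton]; rfl
    have eAD_a : ({a, d} : Finset (Fin h)).erase a = {d} := Finset.erase_insert (by simp [had])
    have eAD_d : ({a, d} : Finset (Fin h)).erase d = {a} := by
      rw [Finset.erase_insert_of_ne had, Finset.erase_singleton]; rfl
    have eAB_a : ({a, b} : Finset (Fin h)).erase a = {b} := Finset.erase_insert (by simp [hab])
    have eAB_b : ({a, b} : Finset (Fin h)).erase b = {a} := by
      rw [Finset.erase_insert_of_ne hab, Finset.erase_singleton]; rfl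
    have cBD : ({b, d} : Finset (Fin h)).card = 2 := Finset.card_pair hbd
    have cAD : ({a, d} : Finset (Fin h)).card = 2 := Finset.card_pair had
    have cAB : ({a, b} : Finset (Fin h)).card = 2 := Finset.card_pair hab
    have hprod3 : ∀ f : Fin h → ℂ, ∏ i ∈ ({a, b, d} : Finset (Fin h)), f i = f a * (f b * f d) := by
      intro f
      rw [Finset.prod_insert hnot_a, Finset.prod_pair hbd]
    have hsum3 : ∀ f : Fin h → ℂ, ∑ i ∈ ({a, b, d} : Finset (Fin h)), f i = f a + (f b + f d) := by
      intro f
      rw [Finset.sum_insert hnot_a, Finset.sum_pair hbd]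
    have hga : ∀ q : Fin K, gam tx {a, b, d} q a =
        tx (some q) b * tx (some q) d +
          (1 / 2) * (tx (some q) b * tx none d + tx (some q) d * tx none b) := by
      intro q
      simp only [gam, Finset.mem_insert, Finset.mem_singleton, true_or, if_true, eA, cBD, Finset.prod_pair hbd,
        Finset.sum_pair hbd, eBD_b, eBD_d, Finset.prod_singleton]
    have hgb : ∀ q : Fin K, gam tx {a, b, d} q b =
        tx (some q) a * tx (some q) d +
          (1 / 2) * (tx (some q) a * tx none d + tx (some q) d * tx none a) := by
      intro q
      simp only [gam, Finset.mem_insert, Finset.mem_singleton, true_or, or_true, if_true, eB, cAD,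
        Finset.prod_pair had, Finset.sum_pair had, eAD_a, eAD_d, Finset.prod_singleton]
    have hgd : ∀ q : Fin K, gam tx {a, b, d} q d =
        tx (some q) a * tx (some q) b +
          (1 / 2) * (tx (some q) a * tx none b + tx (some q) b * tx none a) := by
      intro q
      simp only [gam, Finset.mem_insert, Finset.mem_singleton, or_true, if_true, eD, cAB,
        Finset.prod_pair hab, Finset.sum_pair hab, eAB_a, eAB_b, Finset.prod_singleton]
    rw [hprod3, hprod3, hprod3, hprod3, hsum3, hga, hga, hgb, hgb, hgd, hgd]
    ring

end coefficients

/-! ## Every small row is a combination of the column-functions -/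

section span

variable (u : n → Finset (Fin h)) (e : n → Finset (Fin K)) (S : Finset (Fin K)) (tx : Option (Fin K) → Fin h → ℂ)

/-- **The row identity.** For a two-layer hidden family with pairs inside `S`, every row `i` with `|u i| ≤ 3` of the additive
matrix is, as a function of the column `k`, the fixed combination `Σ_idx coef(idx) · colVec(idx)` of the column-functions. -/
theorem row_eq_sum_coef (he2 : ∀ k, (e k).card ≤ 2) (heS : ∀ k, (e k).card = 2 → e k ⊆ S)
    (i : n) (hi : (u i).card ≤ 3) (k : n) :
    ∏ a ∈ u i, lin tx a (e k) = ∑ idx : ColIdx K h S, coef tx S (u i) idx * colVec e S tx idx k := by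
  classical
  -- split the index sum into its three kinds
  rw [Fintype.sum_sum_type, Fintype.sum_option, Fintype.sum_prod_type]
  simp only [coef, colVec, indFun, mul_one]
  -- case analysis on the hidden set `e k`
  rcases Nat.lt_or_ge (e k).card 1 with h0 | h1
  · -- J = ∅
    have hJ : e k = ∅ := Finset.card_eq_zero.mp (by omega)
    simp [hJ, lin, pairFun]
  rcases Nat.lt_or_ge (e k).card 2 with h1' | h2
  · -- J = {p}
    have hJ1 : (e k).card = 1 := by omega
    obtain ⟨p, hp⟩ := Finset.card_eq_one.mp hJ1
    have hpf : ∀ (s : S) (a : Fin h), pairFun tx (s : Fin K) a (e k) = 0 :=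
      fun s a => pairFun_of_card_le_one tx _ a _ (by omega)
    simp only [hpf, mul_zero, Finset.sum_const_zero, add_zero]
    rw [hp]
    simp only [lin_singleton, Finset.mem_singleton, mul_boole]
    rw [Finset.sum_ite_eq' Finset.univ p]
    simp
  · -- J = {p, p'} ⊆ S
    have hJ2 : (e k).card = 2 := le_antisymm (he2 k) h2
    have hsub : e k ⊆ S := heS k hJ2
    obtain ⟨p, p', hpp, hJ⟩ := Finset.card_eq_two.mp hJ2
    have hpS : p ∈ S := hsub (by rw [hJ]; simp)
    have hp'S : p' ∈ S := hsub (by rw [hJ]; simp)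
    rw [hJ, prod_lin_pair tx (u i) hi hpp]
    -- the indicator part: Σ_q β_q [q ∈ {p,p'}] = β_p + β_p'
    have hind : ∑ q : Fin K, ((∏ a ∈ u i, (tx none a + tx (some q) a)) - ∏ a ∈ u i, tx none a) *
        (if q ∈ ({p, p'} : Finset (Fin K)) then (1 : ℂ) else 0) =
        ((∏ a ∈ u i, (tx none a + tx (some p) a)) - ∏ a ∈ u i, tx none a) +
          ((∏ a ∈ u i, (tx none a + tx (some p') a)) - ∏ a ∈ u i, tx none a) := by
      simp only [mul_boole]
      rw [← Finset.sum_filter, Finset.filter_mem_eq_inter, Finset.univ_inter, Finset.sum_pair hpp]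
    -- the pair part: only the states p, p' contribute
    have hpair : ∑ s : S, ∑ a : Fin h, gam tx (u i) (s : Fin K) a * pairFun tx (s : Fin K) a {p, p'} =
        ∑ a ∈ u i, (gam tx (u i) p a * tx (some p') a + gam tx (u i) p' a * tx (some p) a) := by
      -- restrict the outer sum to the two states
      have hvan : ∀ s : S, (s : Fin K) ≠ p → (s : Fin K) ≠ p' →
          ∑ a : Fin h, gam tx (u i) (s : Fin K) a * pairFun tx (s : Fin K) a {p, p'} = 0 := by
        intro s hs hs'
        exact Finset.sum_eq_zero fun a _ => by rw [pairFun_pair_other tx a hs hs', mul_zero]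
      rw [← Finset.sum_subset (Finset.subset_univ ({⟨p, hpS⟩, ⟨p', hp'S⟩} : Finset S))
        (fun s _ hs => hvan s (fun h' => hs (by simp [Subtype.ext_iff, h']))
          (fun h' => hs (by simp [Subtype.ext_iff, h'])))]
      have hne : (⟨p, hpS⟩ : S) ≠ ⟨p', hp'S⟩ := fun h' => hpp (congrArg Subtype.val h')
      rw [Finset.sum_pair hne]
      simp only [pairFun_pair_left tx _ hpp, pairFun_pair_right tx _ hpp]
      rw [← Finset.sum_add_distrib]
      -- restrict the coordinate sum to `u i` (gam vanishes off the row)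
      symm
      apply Finset.sum_subset (Finset.subset_univ (u i))
      intro a _ ha
      simp [gam, ha]
    rw [hind, hpair]
    ring

/-- **Every small row lies in the span of the `1 + K + |S|·h` column-functions.** -/
theorem row_mem_span (he2 : ∀ k, (e k).card ≤ 2) (heS : ∀ k, (e k).card = 2 → e k ⊆ S)
    (i : n) (hi : (u i).card ≤ 3) :
    (fun k => ∏ a ∈ u i, lin tx a (e k)) ∈ Submodule.span ℂ (Set.range (colVec e S tx)) := by
  classical
  have hfun : (fun k => ∏ a ∈ u i, lin tx a (e k)) =
      ∑ idx : ColIdx K h S, coef tx S (u i) idx • colVec e S tx idx := by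
    funext k
    rw [row_eq_sum_coef u e S tx he2 heS i hi k, Finset.sum_apply]
    rfl
  rw [hfun]
  exact Submodule.sum_mem _ fun idx _ => Submodule.smul_mem _ _ (Submodule.subset_span ⟨idx, rfl⟩)

end span

/-! ## The singular conclusion -/

section determinant

variable [Fintype n] [DecidableEq n]
variable (u : n → Finset (Fin h)) (e : n → Finset (Fin K)) (S : Finset (Fin K))

/-- The number of column-functions is `(K + 1) + |S|·h`. -/
theorem card_colIdx : Fintype.card (ColIdx K h S) = (K + 1) + S.card * h := by
  simp [ColIdx, Fintype.card_sum, Fintype.card_option, Fintype.card_prod, Fintype.card_fin]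

/-- **THE TRIPLE-ROW RANK BOUND, singular form.** If the hidden family is two-layer with its pairs inside `S` and MORE
than `(K + 1) + |S|·h` rows have size `≤ 3`, then the additive matrix is singular for EVERY table. -/
theorem det_eq_zero_of_many_small_rows (he2 : ∀ k, (e k).card ≤ 2) (heS : ∀ k, (e k).card = 2 → e k ⊆ S)
    (hcount : (K + 1) + S.card * h < Fintype.card {i : n // (u i).card ≤ 3})
    (tx : Option (Fin K) → Fin h → ℂ) :
    (Matrix.of fun i k : n => ∏ a ∈ u i, (tx none a + ∑ q ∈ e k, tx (some q) a)).det = 0 := by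
  classical
  set M : Matrix n n ℂ := Matrix.of fun i k : n => ∏ a ∈ u i, (tx none a + ∑ q ∈ e k, tx (some q) a) with hM
  by_contra hdet
  -- the rows of `M` are linearly independent
  have hunit : IsUnit M := (Matrix.isUnit_iff_isUnit_det M).mpr (isUnit_iff_ne_zero.mpr hdet)
  have hrows : LinearIndependent ℂ (fun i : n => M i) := Matrix.linearIndependent_rows_of_isUnit hunit
  -- the small rows, as a family inside the span `W` of the column-functions
  set W : Submodule ℂ (n → ℂ) := Submodule.span ℂ (Set.range (colVec e S tx)) with hW
  have hmem : ∀ i : {i : n // (u i).card ≤ 3}, M (i : n) ∈ W := by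
    intro i
    have : M (i : n) = fun k => ∏ a ∈ u i, lin tx a (e k) := by
      funext k; rw [hM]; rfl
    rw [this]
    exact row_mem_span u e S tx he2 heS i i.2
  let w : {i : n // (u i).card ≤ 3} → W := fun i => ⟨M (i : n), hmem i⟩
  have hw : LinearIndependent ℂ w := by
    apply LinearIndependent.of_comp W.subtype
    exact hrows.comp (fun i : {i : n // (u i).card ≤ 3} => (i : n)) Subtype.val_injective
  have h1 : Fintype.card {i : n // (u i).card ≤ 3} ≤ Module.finrank ℂ W := hw.fintype_card_le_finrank
  have h2 : Module.finrank ℂ W ≤ Fintype.card (ColIdx K h S) := finrank_range_le_card (colVec e S tx)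
  rw [card_colIdx] at h2
  omega

/-- The same in the symbolic language of `…HiddenStatesSplitRule`: under the hypotheses, `u` is NOT symbolically good
against `e` (no table works, so the symbolic determinant — which would have a non-root — is zero). -/
theorem not_symbGood_of_many_small_rows (he2 : ∀ k, (e k).card ≤ 2) (heS : ∀ k, (e k).card = 2 → e k ⊆ S)
    (hcount : (K + 1) + S.card * h < Fintype.card {i : n // (u i).card ≤ 3}) : ¬ SymbGood u e := by
  intro hgood
  obtain ⟨tx, htx⟩ := exists_table_of_symbGood u e hgood
  exact htx (det_eq_zero_of_many_small_rows u e S he2 heS hcount tx)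

end determinant

end TripleRank

end

end Summit.ValiantsHypothesis.ValiantsHypothesis.Theorems.BarrierLever.HiddenStates
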